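/-
Copyright (c) 2026. Released under the Apache 2.0 license.
-/
import Literature.NumberTheory.EllipticCurves.NewformCuspFourierValuationWeightK
import HarnessLib

/-!
# Fourier expansions at the cusps of `Γ₀(N)`: convergence, the right-coset root-of-unity relation,
# and ČNS (4.2.2) — `val_p(f|𝔠)` depends only on the cusp `𝔠`, not on the representative `γ`

Topic `Literature/NumberTheory/EllipticCurves`; namespace
`Literature.NumberTheory.EllipticCurves.ModularForms`. THEOREMS ONLY (no definition, no named fact):
the representative-independence statements of Česnavičius–Neururer–Saha, *The Manin constant and the
modular degree*, J. Eur. Math. Soc. 26 (2024) 573–637, §4.2, p. 609 (version of record; = p. 29 of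
the authors' final version), for the vocabulary `fourierCoeffAtCusp N k f γ n` / `Fuchsian.cuspWidth`
of `NewformCuspFourierValuation.lean` (there: `a_f(n;γ)` := the `n`-th coefficient of Mathlib's
`qExpansion w (f ∣[k] γ)`, `w = w(γ∞) = N/gcd(N, γ₁₀²)`), completing the LEFT-coset half
`fourierCoeffAtCusp_mul_left_of_mem_Gamma0` / `forall_norm_fourierCoeffAtCusp_le_iff_of_mem_Gamma0`
proved in `NewformCuspFourierValuationWeightK.lean` (typing layer D-0088(4), seat bsd-littype-12).

Printed (loc. cit.): "For every modular form `f` of weight `k` on `Γ₀(N)` and every cusp `𝔠 = γ∞`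
with `γ ∈ SL₂(ℤ)`, we have `(f|_k γ)|_k (1 w(𝔠); 0 1) = f|_k γ`, so (4.2.1) gives the Fourier
expansion of `f` at `𝔠`: `(f|_k γ)(z) = ∑_{n ≥ 0} a_f(n;γ) e^{2πinz/w(𝔠)}`, which depends not only on
`𝔠` but also on `γ` — explicitly, for any `γ′ ∈ SL₂(ℤ)` with `𝔠 = γ′∞`,
`a_f(n;γ) = e^{2πint/w(𝔠)} a_f(n;γ′)` for some `t ∈ ℤ` that depends on `γ′⁻¹γ`. In particular, for
any isomorphism `ℚ̄_p ≃ ℂ` and its `p`-adic valuation `val_p : ℂ → ℚ ∪ {∞}`,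
`val_p(f|𝔠) := inf_{n ≥ 0} val_p(a_f(n;γ))` depends only on `f` and `𝔠`, and not on `γ`. (4.2.2)"

## What is proved (all in the kernel; Mathlib's `q`-expansion theory `UpperHalfPlane.qExpansion`,
## `ModularForm.translate`, `ModularFormClass.qExpansion_coeff_unique`)
* `hasSum_fourierCoeffAtCusp` — (4.2.1) at the cusp `γ∞`: `(f|_k γ)(τ) = ∑ a_f(n;γ) q_w^n`,
  `q_w = e^{2πiτ/w}`, CONVERGES, for every `f` in a `ModularFormClass` on `Γ₀(N)` (the width `w` is a
  strict period of `γ⁻¹Γ₀(N)γ`: `cuspWidth_mem_strictPeriods`, from `Fuchsian.conj_T_zpow_mem_Gamma0_iff`).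
* `fourierCoeffAtCusp_mul_T_zpow` — the printed relation with the EXPLICIT `t`:
  `a_f(n; γT^t) = e^{2πint/w} · a_f(n;γ)`; `exists_fourierCoeffAtCusp_mul_right_eq` — for any `σ`
  fixing `∞` (`σ = ±T^t`, `exists_eq_T_zpow_or_eq_neg_T_zpow_of_apply_one_zero_eq_zero`; `-1 ∈ Γ₀(N)`).
* `norm_fourierCoeffAtCusp_mul_right_eq`, `norm_padic_fourierCoeffAtCusp_mul_right_eq` — the factor is
  a root of unity, of complex absolute value `1` and, under any `ι : ℚ̄_p ≃ ℂ`, of `p`-adic norm `1`.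
* `norm_padic_fourierCoeffAtCusp_eq_of_cuspOrbitOf_eq` (+ complex twin, + the width
  `cuspWidth_eq_of_cuspOrbitOf_eq`) — (4.2.2) termwise on the tree's cusp orbits `cuspOrbitOf N γ`
  (`ModularCurveCuspsProofs.lean`: `Γ₀(N)γ∞ = Γ₀(N)γ′∞ ⟺ γ′ ∈ Γ₀(N) γ SL₂(ℤ)_∞`), and
  `forall_norm_fourierCoeffAtCusp_le_iff_of_cuspOrbitOf_eq` — every transcribed bound
  "`‖ι⁻¹a_f(n;γ)‖ ≤ B ∀ n`" (`cesnaviciusNeururerSaha_cor_4_7`, `…thm_4_6`, `…lemma_5_13`, Prop. 5.14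
  right-hand side) is a statement about the cusp of `X₀(N)`.
No `sorry`; no new definition, instance, notation or fact.

## References
* [CesnaviciusNeururerSaha2023] K. Česnavičius, M. Neururer, A. Saha, *The Manin constant and the
  modular degree*, J. Eur. Math. Soc. 26 (2024) 573–637, §4.1–§4.2, pp. 608–609, (4.2.1)–(4.2.2).
* [DiamondShurman2005] F. Diamond, J. Shurman, *A first course in modular forms*, GTM 228, §1.2
  (Fourier expansions, `e^{2πi(τ+t)/w}`), §3.8 (cusps of `Γ₀(N)`).
-/

noncomputable section

open scoped MatrixGroups ModularForm Real Pointwise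
open UpperHalfPlane hiding I
open CongruenceSubgroup Matrix.SpecialLinearGroup Complex Function
open Literature.NumberTheory.Automorphic (Fuchsian.cuspWidth Fuchsian.conj_T_zpow_mem_Gamma0_iff
  Fuchsian.cuspWidth_pos)

namespace Literature.NumberTheory.EllipticCurves.ModularForms

section SlashByTranslation

variable (k : ℤ)

/-- `(f |_k T^t)(τ) = f(τ + t)` (plumbing). [folklore] -/
private theorem slash_T_zpow_apply_eq_vadd (f : ℍ → ℂ) (t : ℤ) (τ : ℍ) :
    (f ∣[k] (ModularGroup.T ^ t)) τ = f ((t : ℝ) +ᵥ τ) := by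
  have h1 : (ModularGroup.T ^ t) 1 0 = 0 := by simp [ModularGroup.coe_T_zpow]
  have h2 : (ModularGroup.T ^ t) 1 1 = 1 := by simp [ModularGroup.coe_T_zpow]
  rw [ModularForm.SL_slash_apply, modular_T_zpow_smul, ModularGroup.denom_apply, h1, h2]
  simp

/-- `T^t ↦ (1 t; 0 1)` in `GL(2, ℝ)` (plumbing). [folklore] -/
private theorem mapGL_T_zpow (t : ℤ) :
    mapGL ℝ (ModularGroup.T ^ t) = Matrix.GeneralLinearGroup.upperRightHom (t : ℝ) := by
  simp only [Units.ext_iff, mapGL_coe_matrix, map_apply_coe]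
  ext i j
  fin_cases i <;> fin_cases j <;> simp [ModularGroup.coe_T_zpow]

/-- Right multiplication by `T^t` does not change the lower-left entry (plumbing). [folklore] -/
private theorem mul_T_zpow_apply_one_zero (γ : SL(2, ℤ)) (t : ℤ) :
    (γ * ModularGroup.T ^ t) 1 0 = γ 1 0 := by
  simp [Matrix.mul_apply, Fin.sum_univ_two, ModularGroup.coe_T_zpow]

/-- **The stabiliser of `∞` in `SL₂(ℤ)`**: an element with lower-left entry `0` is `T^t` or `-T^t`
(Diamond–Shurman §2.4: "`SL₂(ℤ)_∞ = {±(1 m; 0 1) : m ∈ ℤ}`").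
[cite: DiamondShurman2005, §2.4 (display `SL₂(ℤ)_∞ = {±(1 m; 0 1)}`)] -/
theorem exists_eq_T_zpow_or_eq_neg_T_zpow_of_apply_one_zero_eq_zero (σ : SL(2, ℤ))
    (hσ : σ 1 0 = 0) : ∃ t : ℤ, σ = ModularGroup.T ^ t ∨ σ = -ModularGroup.T ^ t := by
  have hdet := σ.det_coe
  rw [Matrix.det_fin_two, hσ, mul_zero, sub_zero] at hdet
  rcases Int.eq_one_or_neg_one_of_mul_eq_one' hdet with ⟨h00, h11⟩ | ⟨h00, h11⟩
  · refine ⟨σ 0 1, Or.inl ?_⟩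
    ext i j
    fin_cases i <;> fin_cases j <;> simp [ModularGroup.coe_T_zpow, h00, h11, hσ]
  · refine ⟨-(σ 0 1), Or.inr ?_⟩
    ext i j
    fin_cases i <;> fin_cases j <;> simp [ModularGroup.coe_T_zpow, h00, h11, hσ]

end SlashByTranslation

section Representative

variable (N : ℕ) [NeZero N] (k : ℤ)

/-- **The width `w(𝔠)` of the cusp `𝔠 = γ∞` of `Γ₀(N)` is a strict period of the conjugate
`γ⁻¹ Γ₀(N) γ`** (`(1 w; 0 1) ∈ γ⁻¹Γ₀(N)γ`; ČNS §4.1: the width is `[SL₂(ℤ)_∞ : Γ₀(N)′_𝔠]` for the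
stabilisers of `γ⁻¹∞ = ∞` in `SL₂(ℤ)` and in `γ⁻¹Γ₀(N)γ`; §4.2: "`(f|_k γ)|_k (1 w(𝔠); 0 1) = f|_k γ`";
tree `Fuchsian.conj_T_zpow_mem_Gamma0_iff`).
[cite: CesnaviciusNeururerSaha2023, §4.1 (p. 608) and §4.2 (p. 609)] -/
theorem cuspWidth_mem_strictPeriods (γ : SL(2, ℤ)) :
    ((Fuchsian.cuspWidth N (γ 1 0) : ℝ)) ∈
      (ConjAct.toConjAct (mapGL ℝ γ)⁻¹ • (Gamma0 N : Subgroup (GL (Fin 2) ℝ))).strictPeriods := by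
  rw [Subgroup.mem_strictPeriods_iff, Subgroup.mem_pointwise_smul_iff_inv_smul_mem, ← map_inv, inv_inv,
    ConjAct.toConjAct_smul]
  have hmem := (Fuchsian.conj_T_zpow_mem_Gamma0_iff N γ (Fuchsian.cuspWidth N (γ 1 0) : ℤ)).2 dvd_rfl
  have hT := mapGL_T_zpow (Fuchsian.cuspWidth N (γ 1 0) : ℤ)
  rw [Int.cast_natCast] at hT
  rw [← hT, ← map_mul, ← map_inv, ← map_mul]
  exact Subgroup.mem_map_of_mem _ hmem

/-- The Fourier expansion at the cusp `γ∞` CONVERGES to `f|_k γ`: for a modular form `f` of weight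
`k` on `Γ₀(N)`, `(f|_k γ)(τ) = ∑_{n ≥ 0} a_f(n;γ) e^{2πinτ/w}`, `w = w(γ∞)` (ČNS §4.2 (4.2.1) and the
display after it). [cite: CesnaviciusNeururerSaha2023, §4.2 (4.2.1) (p. 609)] -/
theorem hasSum_fourierCoeffAtCusp {F : Type*} [FunLike F ℍ ℂ] [ModularFormClass F (Gamma0 N) k]
    (f : F) (γ : SL(2, ℤ)) (τ : ℍ) :
    HasSum (fun n : ℕ ↦ fourierCoeffAtCusp N k ⇑f γ n •
      Periodic.qParam (Fuchsian.cuspWidth N (γ 1 0) : ℝ) τ ^ n) ((⇑f ∣[k] γ) τ) := by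
  set G := ModularForm.translate f (mapGL ℝ γ) with hG
  have hw : (0 : ℝ) < (Fuchsian.cuspWidth N (γ 1 0) : ℝ) := by
    exact_mod_cast Fuchsian.cuspWidth_pos N (γ 1 0)
  have hΓ := cuspWidth_mem_strictPeriods N γ
  haveI : Fact (IsCusp OnePoint.infty
      (ConjAct.toConjAct (mapGL ℝ γ)⁻¹ • (Gamma0 N : Subgroup (GL (Fin 2) ℝ)))) :=
    ⟨Subgroup.isCusp_of_mem_strictPeriods hw hΓ⟩
  have := UpperHalfPlane.hasSum_qExpansion hw (SlashInvariantFormClass.periodic_comp_ofComplex G hΓ)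
    (ModularFormClass.holo G) (ModularFormClass.bdd_at_infty G) τ
  have hcoe : ⇑G = ⇑f ∣[k] γ := rfl
  rwa [hcoe] at this

/-- **The right-coset relation (ČNS §4.2, display before (4.2.2))**: replacing the representative
`γ` of the cusp `𝔠 = γ∞` by `γ T^t` multiplies the `n`-th Fourier coefficient by the root of unity
`e^{2πint/w(𝔠)}`: `a_f(n; γT^t) = e^{2πint/w(𝔠)} · a_f(n; γ)` ("`a_f(n;γ) = e^{2πint/w(𝔠)} a_f(n;γ′)`
for some `t ∈ ℤ` that depends on `γ′⁻¹γ`"). For every modular form of weight `k` on `Γ₀(N)`.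
[cite: CesnaviciusNeururerSaha2023, §4.2, display before (4.2.2) (p. 609)] -/
theorem fourierCoeffAtCusp_mul_T_zpow {F : Type*} [FunLike F ℍ ℂ] [ModularFormClass F (Gamma0 N) k]
    (f : F) (γ : SL(2, ℤ)) (t : ℤ) (n : ℕ) :
    fourierCoeffAtCusp N k ⇑f (γ * ModularGroup.T ^ t) n =
      cexp (2 * π * I * t * n / (Fuchsian.cuspWidth N (γ 1 0) : ℕ)) * fourierCoeffAtCusp N k ⇑f γ n := by
  set w : ℕ := Fuchsian.cuspWidth N (γ 1 0) with hw_def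
  have hw : (0 : ℝ) < (w : ℝ) := by exact_mod_cast Fuchsian.cuspWidth_pos N (γ 1 0)
  have h10 : (γ * ModularGroup.T ^ t) 1 0 = γ 1 0 := mul_T_zpow_apply_one_zero γ t
  -- the translate by `γ T^t` as a modular form, with strict period `w`
  set G' := ModularForm.translate f (mapGL ℝ (γ * ModularGroup.T ^ t)) with hG'
  have hΓ' : (w : ℝ) ∈ (ConjAct.toConjAct (mapGL ℝ (γ * ModularGroup.T ^ t))⁻¹ •
      (Gamma0 N : Subgroup (GL (Fin 2) ℝ))).strictPeriods := by
    have := cuspWidth_mem_strictPeriods N (γ * ModularGroup.T ^ t)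
    rwa [h10] at this
  have hcoe : ⇑G' = ⇑f ∣[k] (γ * ModularGroup.T ^ t) := rfl
  -- the root of unity
  set ζ : ℂ := cexp (2 * π * I * t / w) with hζ
  have hq : ∀ τ : ℍ, Periodic.qParam (w : ℝ) ((t : ℝ) +ᵥ τ) = ζ * Periodic.qParam (w : ℝ) τ := by
    intro τ
    simp only [Periodic.qParam, coe_vadd, hζ, ← Complex.exp_add]
    congr 1
    push_cast
    ring
  -- the expansion of `G'` in terms of the coefficients at `γ`
  have hsum : ∀ τ : ℍ, HasSum (fun m : ℕ ↦ (fourierCoeffAtCusp N k ⇑f γ m * ζ ^ m) •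
      Periodic.qParam (w : ℝ) τ ^ m) (G' τ) := by
    intro τ
    have h1 : G' τ = (⇑f ∣[k] γ) ((t : ℝ) +ᵥ τ) := by
      rw [hcoe, SlashAction.slash_mul, slash_T_zpow_apply_eq_vadd]
    have h2 := hasSum_fourierCoeffAtCusp N k f γ ((t : ℝ) +ᵥ τ)
    rw [← hw_def, hq] at h2
    rw [h1]
    convert h2 using 2 with m
    simp only [smul_eq_mul, mul_pow]
    ring
  have huniq := ModularFormClass.qExpansion_coeff_unique hw hΓ' (f := G') hsum n
  -- conclude
  unfold fourierCoeffAtCusp at huniq ⊢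
  rw [h10, ← hw_def, ← hcoe, ← huniq, hζ, ← Complex.exp_nat_mul, mul_comm]
  congr 2
  ring

omit [NeZero N] in
/-- `-1 ∈ Γ₀(N)` (plumbing; ČNS §4.2: "for `Γ = Γ₀(N)`, choosing `γ = -1` gives
`f(z) = (-1)^k f(z)`"). [folklore] -/
private theorem neg_one_mem_Gamma0 : (-1 : SL(2, ℤ)) ∈ Gamma0 N := by
  simp [Gamma0_mem]

/-- **Right-coset form**: for `σ ∈ SL₂(ℤ)` fixing `∞` (so `σ = ±T^t`), `a_f(n; γσ) = e^{2πint/w}·a_f(n;γ)`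
for some `t ∈ ℤ` (ČNS §4.2: "for some `t ∈ ℤ` that depends on `γ′⁻¹γ`"; the sign `-1 ∈ Γ₀(N)` acts
trivially). [cite: CesnaviciusNeururerSaha2023, §4.2, display before (4.2.2) (p. 609)] -/
theorem exists_fourierCoeffAtCusp_mul_right_eq {F : Type*} [FunLike F ℍ ℂ]
    [ModularFormClass F (Gamma0 N) k] (f : F) (γ : SL(2, ℤ)) {σ : SL(2, ℤ)} (hσ : σ 1 0 = 0) (n : ℕ) :
    ∃ t : ℤ, fourierCoeffAtCusp N k ⇑f (γ * σ) n =
      cexp (2 * π * I * t * n / (Fuchsian.cuspWidth N (γ 1 0) : ℕ)) * fourierCoeffAtCusp N k ⇑f γ n := by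
  obtain ⟨t, h | h⟩ := exists_eq_T_zpow_or_eq_neg_T_zpow_of_apply_one_zero_eq_zero σ hσ
  · exact ⟨t, by rw [h]; exact fourierCoeffAtCusp_mul_T_zpow N k f γ t n⟩
  · refine ⟨t, ?_⟩
    have hγσ : γ * σ = (-1) * (γ * ModularGroup.T ^ t) := by
      rw [h, mul_neg, neg_one_mul]
    rw [hγσ, fourierCoeffAtCusp_mul_left_of_mem_Gamma0 N k f (neg_one_mem_Gamma0 N),
      fourierCoeffAtCusp_mul_T_zpow N k f γ t n]

/-- The roots of unity have absolute value `1`: `|a_f(n; γσ)| = |a_f(n; γ)|` for `σ` fixing `∞`.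
[cite: CesnaviciusNeururerSaha2023, §4.2, display before (4.2.2) (p. 609)] -/
theorem norm_fourierCoeffAtCusp_mul_right_eq {F : Type*} [FunLike F ℍ ℂ]
    [ModularFormClass F (Gamma0 N) k] (f : F) (γ : SL(2, ℤ)) {σ : SL(2, ℤ)} (hσ : σ 1 0 = 0) (n : ℕ) :
    ‖fourierCoeffAtCusp N k ⇑f (γ * σ) n‖ = ‖fourierCoeffAtCusp N k ⇑f γ n‖ := by
  obtain ⟨t, ht⟩ := exists_fourierCoeffAtCusp_mul_right_eq N k f γ hσ n
  have h1 : ‖cexp (2 * π * I * t * n / (Fuchsian.cuspWidth N (γ 1 0) : ℕ))‖ = 1 := by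
    have : (2 * π * I * t * n / (Fuchsian.cuspWidth N (γ 1 0) : ℕ) : ℂ) =
        ((2 * π * t * n / (Fuchsian.cuspWidth N (γ 1 0) : ℕ) : ℝ) : ℂ) * I := by
      push_cast
      ring
    rw [this, Complex.norm_exp_ofReal_mul_I]
  rw [ht, norm_mul, h1, one_mul]

/-- **`p`-adic form**: for any isomorphism `ι : ℚ̄_p ≃ ℂ`, `‖ι⁻¹ a_f(n; γσ)‖ = ‖ι⁻¹ a_f(n; γ)‖` for `σ`
fixing `∞` — `ι⁻¹` of a root of unity is a root of unity of `ℚ̄_p`, of norm `1`; i.e.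
`val_p(a_f(n;γσ)) = val_p(a_f(n;γ))` termwise. [cite: CesnaviciusNeururerSaha2023, §4.2 (4.2.2) (p. 609)] -/
theorem norm_padic_fourierCoeffAtCusp_mul_right_eq {p : ℕ} [Fact p.Prime] {F : Type*} [FunLike F ℍ ℂ]
    [ModularFormClass F (Gamma0 N) k] (f : F) (ι : PadicAlgCl p ≃+* ℂ) (γ : SL(2, ℤ)) {σ : SL(2, ℤ)}
    (hσ : σ 1 0 = 0) (n : ℕ) :
    ‖ι.symm (fourierCoeffAtCusp N k ⇑f (γ * σ) n)‖ = ‖ι.symm (fourierCoeffAtCusp N k ⇑f γ n)‖ := by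
  obtain ⟨t, ht⟩ := exists_fourierCoeffAtCusp_mul_right_eq N k f γ hσ n
  set w : ℕ := Fuchsian.cuspWidth N (γ 1 0) with hw_def
  have hw0 : w ≠ 0 := (Fuchsian.cuspWidth_pos N (γ 1 0)).ne'
  set ζ : ℂ := cexp (2 * π * I * t * n / (w : ℕ)) with hζ
  have hζw : ζ ^ w = 1 := by
    rw [hζ, ← Complex.exp_nat_mul]
    have : (w : ℂ) * (2 * π * I * t * n / (w : ℕ)) = ((t * n : ℤ) : ℂ) * (2 * π * I) := by
      have hw' : (w : ℂ) ≠ 0 := by exact_mod_cast hw0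
      field_simp
      push_cast
      ring
    rw [this]
    exact Complex.exp_int_mul_two_pi_mul_I _
  have hnorm : ‖ι.symm ζ‖ = 1 := by
    have h1 : ‖ι.symm ζ‖ ^ w = 1 := by
      rw [← norm_pow, ← map_pow, hζw, map_one, norm_one]
    exact (pow_eq_one_iff_of_nonneg (norm_nonneg _) hw0).mp h1
  rw [ht, map_mul, norm_mul, hnorm, one_mul]

/-- **ČNS (4.2.2): `val_p(f|𝔠) := inf_n val_p(a_f(n;γ))` depends only on `f` and the cusp `𝔠`, and not
on `γ`** — termwise: if `γ`, `γ′` define the same cusp of `X₀(N)` (`Γ₀(N)γ∞ = Γ₀(N)γ′∞`, tree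
`cuspOrbitOf`), then `‖ι⁻¹ a_f(n;γ′)‖ = ‖ι⁻¹ a_f(n;γ)‖` for every `n` (`γ′ = δγσ` with `δ ∈ Γ₀(N)` —
left-invariance `fourierCoeffAtCusp_mul_left_of_mem_Gamma0` — and `σ` fixing `∞` — roots of unity).
[cite: CesnaviciusNeururerSaha2023, §4.2 (4.2.2) (p. 609)] -/
theorem norm_padic_fourierCoeffAtCusp_eq_of_cuspOrbitOf_eq {p : ℕ} [Fact p.Prime] {F : Type*}
    [FunLike F ℍ ℂ] [ModularFormClass F (Gamma0 N) k] (f : F) (ι : PadicAlgCl p ≃+* ℂ)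
    {γ γ' : SL(2, ℤ)} (h : cuspOrbitOf N γ = cuspOrbitOf N γ') (n : ℕ) :
    ‖ι.symm (fourierCoeffAtCusp N k ⇑f γ' n)‖ = ‖ι.symm (fourierCoeffAtCusp N k ⇑f γ n)‖ := by
  obtain ⟨δ, hδ, h0⟩ := (cuspOrbitOf_eq_iff N γ γ').1 h
  have hγ' : γ' = δ⁻¹ * (γ * (γ⁻¹ * δ * γ')) := by group
  rw [hγ', fourierCoeffAtCusp_mul_left_of_mem_Gamma0 N k f (inv_mem hδ),
    norm_padic_fourierCoeffAtCusp_mul_right_eq N k f ι γ h0]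

/-- The same over `ℂ`: `|a_f(n;γ′)| = |a_f(n;γ)|` whenever `Γ₀(N)γ∞ = Γ₀(N)γ′∞`.
[cite: CesnaviciusNeururerSaha2023, §4.2 (4.2.2) (p. 609)] -/
theorem norm_fourierCoeffAtCusp_eq_of_cuspOrbitOf_eq {F : Type*} [FunLike F ℍ ℂ]
    [ModularFormClass F (Gamma0 N) k] (f : F) {γ γ' : SL(2, ℤ)}
    (h : cuspOrbitOf N γ = cuspOrbitOf N γ') (n : ℕ) :
    ‖fourierCoeffAtCusp N k ⇑f γ' n‖ = ‖fourierCoeffAtCusp N k ⇑f γ n‖ := by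
  obtain ⟨δ, hδ, h0⟩ := (cuspOrbitOf_eq_iff N γ γ').1 h
  have hγ' : γ' = δ⁻¹ * (γ * (γ⁻¹ * δ * γ')) := by group
  rw [hγ', fourierCoeffAtCusp_mul_left_of_mem_Gamma0 N k f (inv_mem hδ),
    norm_fourierCoeffAtCusp_mul_right_eq N k f γ h0]

omit [NeZero N] in
/-- The width, too, is right-invariant: `w((γσ)∞) = w(γ∞)` for `σ` fixing `∞` (`(γσ)₁₀ = ±γ₁₀`).
[cite: CesnaviciusNeururerSaha2023, §4.1 (p. 608)] -/
theorem cuspWidth_mul_right_of_apply_one_zero_eq_zero (γ : SL(2, ℤ)) {σ : SL(2, ℤ)} (hσ : σ 1 0 = 0) :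
    Fuchsian.cuspWidth N ((γ * σ) 1 0) = Fuchsian.cuspWidth N (γ 1 0) := by
  obtain ⟨t, h | h⟩ := exists_eq_T_zpow_or_eq_neg_T_zpow_of_apply_one_zero_eq_zero σ hσ
  · rw [h, mul_T_zpow_apply_one_zero]
  · have h10 : (γ * σ) 1 0 = -(γ 1 0) := by
      rw [h, mul_neg, Matrix.SpecialLinearGroup.coe_neg, Matrix.neg_apply, mul_T_zpow_apply_one_zero]
    rw [h10]
    simp [Fuchsian.cuspWidth]

/-- **The width `w(𝔠)` is a function of the cusp `𝔠 ∈ X₀(N)`**: `Γ₀(N)γ∞ = Γ₀(N)γ′∞ ⟹ w(γ′∞) = w(γ∞)`.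
[cite: CesnaviciusNeururerSaha2023, §4.1 (p. 608)] -/
theorem cuspWidth_eq_of_cuspOrbitOf_eq {γ γ' : SL(2, ℤ)} (h : cuspOrbitOf N γ = cuspOrbitOf N γ') :
    Fuchsian.cuspWidth N (γ' 1 0) = Fuchsian.cuspWidth N (γ 1 0) := by
  obtain ⟨δ, hδ, h0⟩ := (cuspOrbitOf_eq_iff N γ γ').1 h
  have hγ' : γ' = δ⁻¹ * (γ * (γ⁻¹ * δ * γ')) := by group
  rw [hγ', cuspWidth_mul_left_of_mem_Gamma0 N (inv_mem hδ),
    cuspWidth_mul_right_of_apply_one_zero_eq_zero N γ h0]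

/-- **(4.2.2) for the transcribed valuation statements**: every bound "`‖ι⁻¹ a_f(n;γ)‖ ≤ B` for all
`n`" (the form in which `val_p(f|𝔠) ≥ -log_p B` is transcribed in `NewformCuspFourierValuation*.lean`)
is a statement about the CUSP `𝔠 = Γ₀(N)γ∞ ∈ X₀(N)`, independent of the representative `γ`.
[cite: CesnaviciusNeururerSaha2023, §4.2 (4.2.2) (p. 609)] -/
theorem forall_norm_fourierCoeffAtCusp_le_iff_of_cuspOrbitOf_eq {p : ℕ} [Fact p.Prime] {F : Type*}
    [FunLike F ℍ ℂ] [ModularFormClass F (Gamma0 N) k] (f : F) (ι : PadicAlgCl p ≃+* ℂ)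
    {γ γ' : SL(2, ℤ)} (h : cuspOrbitOf N γ = cuspOrbitOf N γ') (B : ℝ) :
    (∀ n, ‖ι.symm (fourierCoeffAtCusp N k ⇑f γ' n)‖ ≤ B) ↔
      ∀ n, ‖ι.symm (fourierCoeffAtCusp N k ⇑f γ n)‖ ≤ B := by
  simp_rw [norm_padic_fourierCoeffAtCusp_eq_of_cuspOrbitOf_eq N k f ι h]

end Representative

end Literature.NumberTheory.EllipticCurves.ModularForms

end
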